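import Literature.Geometry.ComplexHyperbolic.UnitBallFrameTransport        -- ★∕filed W3: the flows `ρ_u(θ)`, `hasDerivAt_flowRot_conj_zero`, `mulLeftRight_conjTranspose_apply`
import Literature.Analysis.Calculus.NestedFDerivCompContinuousLinear        -- ★ W3-a: `Dʲ(Θ∘A)(x)[v…] = DʲΘ(Ax)[Av…]`
import Literature.Analysis.Calculus.NestedFDerivAlongCurves                 -- ★ Leibniz for nested jets along curves
import Literature.Analysis.Calculus.NestedFDerivSymmetric                   -- ★ `iteratedFDeriv_four_eq_nestedFDeriv`
import HarnessLib

/-!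
# Infinitesimal `K`-invariance: the jet NULL RELATIONS `D^{j+1}Θ(M)[[X̃,M], Y₁, …, Y_j] + Σᵢ DʲΘ(M)[Y₁, …, [X̃,Yᵢ], …, Y_j] = 0` (`j ≤ 3`) of a test function
# invariant under the one-parameter unitary group `ρ_u(θ)` of `U(2) × U(1) ⊂ U(2,1)` (Helgason 2000 Ch. II §4; Hörmander ALPDO I Thm. 1.1.7; Rogawski 1990 §8.4)

Topic `Geometry/ComplexHyperbolic`; namespace `Literature.Geometry.ComplexHyperbolic.BallModel`.  THEOREMS ONLY (no `def`, no instance, no notation, no axiom, no named fact,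
no `sorry`).  Cell `pub/hodgecm-mathlib`, ENGINE T1 (crux H413 = `stmt-HodgeConjecture-24833`); ROAD A, (A4-iii) «THE VALUE», work package **W6-ang in its `K`-invariant form**
(blueprint `F0/P3a/F0P3a-p06/g12/BLUEPRINT-A4iii-ValueIdentity.F0P3a-p06g12.md`, design `DESIGN-W6-Assembly.F0P3a-p06g12.md` §3); author F0P3a-p06 (g12), 2026-09-01.

WHY.  By ★ p05 `UnitBallOrbitalKAverage` (`Φ_Θ = m_K(K)⁻¹ • Φ_{Θ^K}`, `Θ^K(ζ•1) = m_K(K) • Θ(ζ•1)`) the value theorem of (A4-iii) may be proved for `K`-CONJUGATION-INVARIANT `Θ` only.  For such `Θ`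
the angular part `r³·(𝒟_A F_A + 𝒟_B F_B)` of the ray identity `r³·k = ∂_rK + r³·(𝒟_A F_A + 𝒟_B F_B)` (★ W4 `UnitBallCentreValueIdentityOrder*`, `ang` chunks) vanishes TERMWISE: each angular
term is `c·rⁿ` times a null relation below, with `X̃ = X̃_u = ūE₀₁ − uE₁₀` (`u = 1`: `X̃_A = E₀₁ − E₁₀`; `u = −i`: `X̃_B = i(E₀₁ + E₁₀)`), so no flow-divergence integration is needed.
PROOF of each relation: `g(θ) := DʲΘ(Ad_{ρ_u(θ)}M)[Ad_{ρ_u(θ)}Y₁]…` is CONSTANT (`= Dʲ(Θ∘Ad_{ρ_u(θ)})(M)[Y…]` by ★ `nestedFDeriv_*_comp_clm` with the CLM `mulLeftRight ρ ρᴴ`, and `Θ∘Ad_ρ = Θ`),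
while ★ `hasDerivAt_*_apply_curves` + ★ `hasDerivAt_flowRot_conj_zero` compute `g′(0)` as the displayed sum; uniqueness of derivatives.
* `flowRot_invariant_nestedFDeriv_{one,two,three}_eq` (constancy), **`kInvariant_null_order{0,1,2,3}`** (the relations; `Θ ∈ C¹, C², C³, C⁴`).
HONEST LABEL: HC_CM is proved only modulo the printed citations until rung 0 closes; this file is calculus over ★ files and pays nothing by itself.

## References
* [Helgason2000] S. Helgason, *Groups and Geometric Analysis* (2000), Ch. II §4 (invariant differential operators; infinitesimal action of `K`).
* [HormanderALPDO1] L. Hörmander, *The Analysis of Linear Partial Differential Operators I*, 2nd ed. (1990), Thm. 1.1.7 (chain rule), (8.12)-type Leibniz.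
* [Rogawski1990] J. D. Rogawski, *Automorphic Representations of Unitary Groups in Three Variables*, Ann. of Math. Stud. 123 (1990), §8.4 pp. 126–127.
-/

noncomputable section

open Set Filter Topology Matrix Complex
open scoped Matrix.Norms.Operator ComplexConjugate

namespace Literature.Geometry.ComplexHyperbolic.BallModel

open Literature.Analysis.Calculus

section Nulls

/-- Invariance of `Θ` under `Ad ρ_u(θ)` makes `Θ ∘ Ad ρ_u(θ) = Θ` as functions, with `Ad ρ` the CLM `mulLeftRight ρ ρᴴ`. [cite: Helgason2000, Ch. II §4] -/
theorem comp_mulLeftRight_flowRot_eq {G : Type*} (Θ : Matrix (Fin 3) (Fin 3) ℂ → G) (u : ℂ)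
    (hΘK : ∀ (θ : ℝ) (X : Matrix (Fin 3) (Fin 3) ℂ),
      Θ ((!![(Real.cos θ : ℂ), star u * (Real.sin θ : ℂ), 0; -(u * (Real.sin θ : ℂ)), (Real.cos θ : ℂ), 0; 0, 0, 1] : Matrix (Fin 3) (Fin 3) ℂ) * X *
        (!![(Real.cos θ : ℂ), star u * (Real.sin θ : ℂ), 0; -(u * (Real.sin θ : ℂ)), (Real.cos θ : ℂ), 0; 0, 0, 1] : Matrix (Fin 3) (Fin 3) ℂ)ᴴ) = Θ X) (θ : ℝ) :
    Θ ∘ (ContinuousLinearMap.mulLeftRight ℝ (Matrix (Fin 3) (Fin 3) ℂ)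
        (!![(Real.cos θ : ℂ), star u * (Real.sin θ : ℂ), 0; -(u * (Real.sin θ : ℂ)), (Real.cos θ : ℂ), 0; 0, 0, 1] : Matrix (Fin 3) (Fin 3) ℂ)
        (!![(Real.cos θ : ℂ), star u * (Real.sin θ : ℂ), 0; -(u * (Real.sin θ : ℂ)), (Real.cos θ : ℂ), 0; 0, 0, 1] : Matrix (Fin 3) (Fin 3) ℂ)ᴴ) = Θ := by
  funext X
  simp only [Function.comp_apply, ContinuousLinearMap.mulLeftRight_apply]
  exact hΘK θ X

variable {G : Type*} [NormedAddCommGroup G] [NormedSpace ℝ G]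

/-- **NULL RELATION OF ORDER 0**: `DΘ(M)[X̃M − MX̃] = 0` for `Θ ∈ C¹` invariant under `Ad ρ_u(θ)`, `X̃ = ūE₀₁ − uE₁₀`. [cite: Helgason2000, Ch. II §4] [cite: Rogawski1990, §8.4 pp. 126–127] -/
theorem kInvariant_null_order0 (Θ : Matrix (Fin 3) (Fin 3) ℂ → G) {n : WithTop ℕ∞} (hΘ : ContDiff ℝ n Θ) (hn : n ≠ 0) (u : ℂ)
    (hΘK : ∀ (θ : ℝ) (X : Matrix (Fin 3) (Fin 3) ℂ),
      Θ ((!![(Real.cos θ : ℂ), star u * (Real.sin θ : ℂ), 0; -(u * (Real.sin θ : ℂ)), (Real.cos θ : ℂ), 0; 0, 0, 1] : Matrix (Fin 3) (Fin 3) ℂ) * X *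
        (!![(Real.cos θ : ℂ), star u * (Real.sin θ : ℂ), 0; -(u * (Real.sin θ : ℂ)), (Real.cos θ : ℂ), 0; 0, 0, 1] : Matrix (Fin 3) (Fin 3) ℂ)ᴴ) = Θ X)
    (M : Matrix (Fin 3) (Fin 3) ℂ) :
    fderiv ℝ Θ M ((!![(0 : ℂ), star u, 0; -u, 0, 0; 0, 0, 0] : Matrix (Fin 3) (Fin 3) ℂ) * M - M * !![(0 : ℂ), star u, 0; -u, 0, 0; 0, 0, 0]) = 0 := by
  -- the curve `θ ↦ Θ(Ad ρ_u(θ) M)` is constant …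
  have hconst : (fun θ : ℝ => Θ ((!![(Real.cos θ : ℂ), star u * (Real.sin θ : ℂ), 0; -(u * (Real.sin θ : ℂ)), (Real.cos θ : ℂ), 0; 0, 0, 1] : Matrix (Fin 3) (Fin 3) ℂ) * M *
        (!![(Real.cos θ : ℂ), star u * (Real.sin θ : ℂ), 0; -(u * (Real.sin θ : ℂ)), (Real.cos θ : ℂ), 0; 0, 0, 1] : Matrix (Fin 3) (Fin 3) ℂ)ᴴ)) = fun _ => Θ M := by
    funext θ; exact hΘK θ M
  -- … and has derivative `DΘ(M)[X̃M − MX̃]` at `0`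
  have hd := (hasDerivAt_apply_curve hΘ hn (hasDerivAt_flowRot_conj_zero u M)).congr_of_eventuallyEq (f₁ := fun _ : ℝ => Θ M)
    (Eventually.of_forall fun θ => (congrFun hconst θ).symm)
  have h0 := (hasDerivAt_const (0 : ℝ) (Θ M)).unique hd
  rw [flowRot_zero, conjTranspose_one, Matrix.one_mul, Matrix.mul_one] at h0
  exact h0.symm

/-- Constancy at order one: `DΘ(Ad_ρ M)[Ad_ρ Y] = DΘ(M)[Y]` for `Θ ∈ C¹` invariant under `Ad ρ = Ad ρ_u(θ)`. [cite: Helgason2000, Ch. II §4] -/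
theorem flowRot_invariant_fderiv_apply_eq (Θ : Matrix (Fin 3) (Fin 3) ℂ → G) {n : WithTop ℕ∞} (hΘ : ContDiff ℝ n Θ) (hn : n ≠ 0) (u : ℂ)
    (hΘK : ∀ (θ : ℝ) (X : Matrix (Fin 3) (Fin 3) ℂ),
      Θ ((!![(Real.cos θ : ℂ), star u * (Real.sin θ : ℂ), 0; -(u * (Real.sin θ : ℂ)), (Real.cos θ : ℂ), 0; 0, 0, 1] : Matrix (Fin 3) (Fin 3) ℂ) * X *
        (!![(Real.cos θ : ℂ), star u * (Real.sin θ : ℂ), 0; -(u * (Real.sin θ : ℂ)), (Real.cos θ : ℂ), 0; 0, 0, 1] : Matrix (Fin 3) (Fin 3) ℂ)ᴴ) = Θ X)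
    (θ : ℝ) (M Y : Matrix (Fin 3) (Fin 3) ℂ) :
    fderiv ℝ Θ ((!![(Real.cos θ : ℂ), star u * (Real.sin θ : ℂ), 0; -(u * (Real.sin θ : ℂ)), (Real.cos θ : ℂ), 0; 0, 0, 1] : Matrix (Fin 3) (Fin 3) ℂ) * M *
        (!![(Real.cos θ : ℂ), star u * (Real.sin θ : ℂ), 0; -(u * (Real.sin θ : ℂ)), (Real.cos θ : ℂ), 0; 0, 0, 1] : Matrix (Fin 3) (Fin 3) ℂ)ᴴ)
      ((!![(Real.cos θ : ℂ), star u * (Real.sin θ : ℂ), 0; -(u * (Real.sin θ : ℂ)), (Real.cos θ : ℂ), 0; 0, 0, 1] : Matrix (Fin 3) (Fin 3) ℂ) * Y *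
        (!![(Real.cos θ : ℂ), star u * (Real.sin θ : ℂ), 0; -(u * (Real.sin θ : ℂ)), (Real.cos θ : ℂ), 0; 0, 0, 1] : Matrix (Fin 3) (Fin 3) ℂ)ᴴ) = fderiv ℝ Θ M Y := by
  have hcomp := comp_mulLeftRight_flowRot_eq Θ u hΘK θ
  have h := fderiv_comp_clm_apply
    (ContinuousLinearMap.mulLeftRight ℝ (Matrix (Fin 3) (Fin 3) ℂ) (!![(Real.cos θ : ℂ), star u * (Real.sin θ : ℂ), 0; -(u * (Real.sin θ : ℂ)), (Real.cos θ : ℂ), 0; 0, 0, 1] : Matrix (Fin 3) (Fin 3) ℂ) (!![(Real.cos θ : ℂ), star u * (Real.sin θ : ℂ), 0; -(u * (Real.sin θ : ℂ)), (Real.cos θ : ℂ), 0; 0, 0, 1] : Matrix (Fin 3) (Fin 3) ℂ)ᴴ) (Θ := Θ) (x := M) ((hΘ.differentiable hn) _) Y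
  rw [hcomp] at h
  simp only [ContinuousLinearMap.mulLeftRight_apply] at h
  exact h.symm

/-- **NULL RELATION OF ORDER 1**: `D²Θ(M)[X̃M − MX̃][Y] + DΘ(M)[X̃Y − YX̃] = 0` for `Θ ∈ C²` invariant under `Ad ρ_u(θ)`. [cite: Helgason2000, Ch. II §4] [cite: Rogawski1990, §8.4 pp. 126–127] -/
theorem kInvariant_null_order1 (Θ : Matrix (Fin 3) (Fin 3) ℂ → G) (hΘ : ContDiff ℝ 2 Θ) (u : ℂ)
    (hΘK : ∀ (θ : ℝ) (X : Matrix (Fin 3) (Fin 3) ℂ),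
      Θ ((!![(Real.cos θ : ℂ), star u * (Real.sin θ : ℂ), 0; -(u * (Real.sin θ : ℂ)), (Real.cos θ : ℂ), 0; 0, 0, 1] : Matrix (Fin 3) (Fin 3) ℂ) * X *
        (!![(Real.cos θ : ℂ), star u * (Real.sin θ : ℂ), 0; -(u * (Real.sin θ : ℂ)), (Real.cos θ : ℂ), 0; 0, 0, 1] : Matrix (Fin 3) (Fin 3) ℂ)ᴴ) = Θ X)
    (M Y : Matrix (Fin 3) (Fin 3) ℂ) :
    fderiv ℝ (fderiv ℝ Θ) M ((!![(0 : ℂ), star u, 0; -u, 0, 0; 0, 0, 0] : Matrix (Fin 3) (Fin 3) ℂ) * M - M * !![(0 : ℂ), star u, 0; -u, 0, 0; 0, 0, 0]) Y +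
      fderiv ℝ Θ M ((!![(0 : ℂ), star u, 0; -u, 0, 0; 0, 0, 0] : Matrix (Fin 3) (Fin 3) ℂ) * Y - Y * !![(0 : ℂ), star u, 0; -u, 0, 0; 0, 0, 0]) = 0 := by
  have hconst : (fun θ : ℝ => fderiv ℝ Θ ((!![(Real.cos θ : ℂ), star u * (Real.sin θ : ℂ), 0; -(u * (Real.sin θ : ℂ)), (Real.cos θ : ℂ), 0; 0, 0, 1] : Matrix (Fin 3) (Fin 3) ℂ) * M *
        (!![(Real.cos θ : ℂ), star u * (Real.sin θ : ℂ), 0; -(u * (Real.sin θ : ℂ)), (Real.cos θ : ℂ), 0; 0, 0, 1] : Matrix (Fin 3) (Fin 3) ℂ)ᴴ)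
      ((!![(Real.cos θ : ℂ), star u * (Real.sin θ : ℂ), 0; -(u * (Real.sin θ : ℂ)), (Real.cos θ : ℂ), 0; 0, 0, 1] : Matrix (Fin 3) (Fin 3) ℂ) * Y *
        (!![(Real.cos θ : ℂ), star u * (Real.sin θ : ℂ), 0; -(u * (Real.sin θ : ℂ)), (Real.cos θ : ℂ), 0; 0, 0, 1] : Matrix (Fin 3) (Fin 3) ℂ)ᴴ)) = fun _ => fderiv ℝ Θ M Y := by
    funext θ; exact flowRot_invariant_fderiv_apply_eq Θ hΘ two_ne_zero u hΘK θ M Y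
  have hd := (hasDerivAt_fderiv_apply_curves hΘ (hasDerivAt_flowRot_conj_zero u M) (hasDerivAt_flowRot_conj_zero u Y)).congr_of_eventuallyEq
    (f₁ := fun _ : ℝ => fderiv ℝ Θ M Y) (Eventually.of_forall fun θ => (congrFun hconst θ).symm)
  have h0 := (hasDerivAt_const (0 : ℝ) (fderiv ℝ Θ M Y)).unique hd
  rw [flowRot_zero, conjTranspose_one, Matrix.one_mul, Matrix.mul_one, Matrix.one_mul, Matrix.mul_one] at h0
  exact h0.symm

/-- Constancy at order two: `D²Θ(Ad_ρ M)[Ad_ρ Y₁][Ad_ρ Y₂] = D²Θ(M)[Y₁][Y₂]` for `Θ ∈ C²` invariant under `Ad ρ_u(θ)`. [cite: Helgason2000, Ch. II §4] -/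
theorem flowRot_invariant_nestedFDeriv_two_eq (Θ : Matrix (Fin 3) (Fin 3) ℂ → G) (hΘ : ContDiff ℝ 2 Θ) (u : ℂ)
    (hΘK : ∀ (θ : ℝ) (X : Matrix (Fin 3) (Fin 3) ℂ),
      Θ ((!![(Real.cos θ : ℂ), star u * (Real.sin θ : ℂ), 0; -(u * (Real.sin θ : ℂ)), (Real.cos θ : ℂ), 0; 0, 0, 1] : Matrix (Fin 3) (Fin 3) ℂ) * X *
        (!![(Real.cos θ : ℂ), star u * (Real.sin θ : ℂ), 0; -(u * (Real.sin θ : ℂ)), (Real.cos θ : ℂ), 0; 0, 0, 1] : Matrix (Fin 3) (Fin 3) ℂ)ᴴ) = Θ X)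
    (θ : ℝ) (M Y₁ Y₂ : Matrix (Fin 3) (Fin 3) ℂ) :
    fderiv ℝ (fderiv ℝ Θ) ((!![(Real.cos θ : ℂ), star u * (Real.sin θ : ℂ), 0; -(u * (Real.sin θ : ℂ)), (Real.cos θ : ℂ), 0; 0, 0, 1] : Matrix (Fin 3) (Fin 3) ℂ) * M *
        (!![(Real.cos θ : ℂ), star u * (Real.sin θ : ℂ), 0; -(u * (Real.sin θ : ℂ)), (Real.cos θ : ℂ), 0; 0, 0, 1] : Matrix (Fin 3) (Fin 3) ℂ)ᴴ)
      ((!![(Real.cos θ : ℂ), star u * (Real.sin θ : ℂ), 0; -(u * (Real.sin θ : ℂ)), (Real.cos θ : ℂ), 0; 0, 0, 1] : Matrix (Fin 3) (Fin 3) ℂ) * Y₁ *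
        (!![(Real.cos θ : ℂ), star u * (Real.sin θ : ℂ), 0; -(u * (Real.sin θ : ℂ)), (Real.cos θ : ℂ), 0; 0, 0, 1] : Matrix (Fin 3) (Fin 3) ℂ)ᴴ)
      ((!![(Real.cos θ : ℂ), star u * (Real.sin θ : ℂ), 0; -(u * (Real.sin θ : ℂ)), (Real.cos θ : ℂ), 0; 0, 0, 1] : Matrix (Fin 3) (Fin 3) ℂ) * Y₂ *
        (!![(Real.cos θ : ℂ), star u * (Real.sin θ : ℂ), 0; -(u * (Real.sin θ : ℂ)), (Real.cos θ : ℂ), 0; 0, 0, 1] : Matrix (Fin 3) (Fin 3) ℂ)ᴴ) =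
      fderiv ℝ (fderiv ℝ Θ) M Y₁ Y₂ := by
  have hcomp := comp_mulLeftRight_flowRot_eq Θ u hΘK θ
  have h := nestedFDeriv_two_comp_clm (ContinuousLinearMap.mulLeftRight ℝ (Matrix (Fin 3) (Fin 3) ℂ) (!![(Real.cos θ : ℂ), star u * (Real.sin θ : ℂ), 0; -(u * (Real.sin θ : ℂ)), (Real.cos θ : ℂ), 0; 0, 0, 1] : Matrix (Fin 3) (Fin 3) ℂ) (!![(Real.cos θ : ℂ), star u * (Real.sin θ : ℂ), 0; -(u * (Real.sin θ : ℂ)), (Real.cos θ : ℂ), 0; 0, 0, 1] : Matrix (Fin 3) (Fin 3) ℂ)ᴴ) hΘ M Y₁ Y₂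
  rw [hcomp] at h
  simp only [ContinuousLinearMap.mulLeftRight_apply] at h
  exact h.symm

/-- **NULL RELATION OF ORDER 2**: `D³Θ(M)[X̃M − MX̃][Y₁][Y₂] + D²Θ(M)[X̃Y₁ − Y₁X̃][Y₂] + D²Θ(M)[Y₁][X̃Y₂ − Y₂X̃] = 0` for `Θ ∈ C³` invariant under `Ad ρ_u(θ)`.
[cite: Helgason2000, Ch. II §4] [cite: Rogawski1990, §8.4 pp. 126–127] -/
theorem kInvariant_null_order2 (Θ : Matrix (Fin 3) (Fin 3) ℂ → G) (hΘ : ContDiff ℝ 3 Θ) (u : ℂ)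
    (hΘK : ∀ (θ : ℝ) (X : Matrix (Fin 3) (Fin 3) ℂ),
      Θ ((!![(Real.cos θ : ℂ), star u * (Real.sin θ : ℂ), 0; -(u * (Real.sin θ : ℂ)), (Real.cos θ : ℂ), 0; 0, 0, 1] : Matrix (Fin 3) (Fin 3) ℂ) * X *
        (!![(Real.cos θ : ℂ), star u * (Real.sin θ : ℂ), 0; -(u * (Real.sin θ : ℂ)), (Real.cos θ : ℂ), 0; 0, 0, 1] : Matrix (Fin 3) (Fin 3) ℂ)ᴴ) = Θ X)
    (M Y₁ Y₂ : Matrix (Fin 3) (Fin 3) ℂ) :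
    fderiv ℝ (fderiv ℝ (fderiv ℝ Θ)) M ((!![(0 : ℂ), star u, 0; -u, 0, 0; 0, 0, 0] : Matrix (Fin 3) (Fin 3) ℂ) * M - M * !![(0 : ℂ), star u, 0; -u, 0, 0; 0, 0, 0]) Y₁ Y₂ +
      fderiv ℝ (fderiv ℝ Θ) M ((!![(0 : ℂ), star u, 0; -u, 0, 0; 0, 0, 0] : Matrix (Fin 3) (Fin 3) ℂ) * Y₁ - Y₁ * !![(0 : ℂ), star u, 0; -u, 0, 0; 0, 0, 0]) Y₂ +
      fderiv ℝ (fderiv ℝ Θ) M Y₁ ((!![(0 : ℂ), star u, 0; -u, 0, 0; 0, 0, 0] : Matrix (Fin 3) (Fin 3) ℂ) * Y₂ - Y₂ * !![(0 : ℂ), star u, 0; -u, 0, 0; 0, 0, 0]) = 0 := by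
  have hconst : (fun θ : ℝ => fderiv ℝ (fderiv ℝ Θ) ((!![(Real.cos θ : ℂ), star u * (Real.sin θ : ℂ), 0; -(u * (Real.sin θ : ℂ)), (Real.cos θ : ℂ), 0; 0, 0, 1] : Matrix (Fin 3) (Fin 3) ℂ) * M *
        (!![(Real.cos θ : ℂ), star u * (Real.sin θ : ℂ), 0; -(u * (Real.sin θ : ℂ)), (Real.cos θ : ℂ), 0; 0, 0, 1] : Matrix (Fin 3) (Fin 3) ℂ)ᴴ)
      ((!![(Real.cos θ : ℂ), star u * (Real.sin θ : ℂ), 0; -(u * (Real.sin θ : ℂ)), (Real.cos θ : ℂ), 0; 0, 0, 1] : Matrix (Fin 3) (Fin 3) ℂ) * Y₁ *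
        (!![(Real.cos θ : ℂ), star u * (Real.sin θ : ℂ), 0; -(u * (Real.sin θ : ℂ)), (Real.cos θ : ℂ), 0; 0, 0, 1] : Matrix (Fin 3) (Fin 3) ℂ)ᴴ)
      ((!![(Real.cos θ : ℂ), star u * (Real.sin θ : ℂ), 0; -(u * (Real.sin θ : ℂ)), (Real.cos θ : ℂ), 0; 0, 0, 1] : Matrix (Fin 3) (Fin 3) ℂ) * Y₂ *
        (!![(Real.cos θ : ℂ), star u * (Real.sin θ : ℂ), 0; -(u * (Real.sin θ : ℂ)), (Real.cos θ : ℂ), 0; 0, 0, 1] : Matrix (Fin 3) (Fin 3) ℂ)ᴴ)) =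
      fun _ => fderiv ℝ (fderiv ℝ Θ) M Y₁ Y₂ := by
    funext θ; exact flowRot_invariant_nestedFDeriv_two_eq Θ (hΘ.of_le (by norm_cast)) u hΘK θ M Y₁ Y₂
  have hd := (hasDerivAt_nestedFDeriv_two_apply_curves hΘ (hasDerivAt_flowRot_conj_zero u M) (hasDerivAt_flowRot_conj_zero u Y₁)
    (hasDerivAt_flowRot_conj_zero u Y₂)).congr_of_eventuallyEq (f₁ := fun _ : ℝ => fderiv ℝ (fderiv ℝ Θ) M Y₁ Y₂)
    (Eventually.of_forall fun θ => (congrFun hconst θ).symm)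
  have h0 := (hasDerivAt_const (0 : ℝ) (fderiv ℝ (fderiv ℝ Θ) M Y₁ Y₂)).unique hd
  rw [flowRot_zero, conjTranspose_one] at h0
  simp only [Matrix.one_mul, Matrix.mul_one] at h0
  exact h0.symm

/-- Constancy at order three: `D³Θ(Ad_ρ M)[Ad_ρ Y₁][Ad_ρ Y₂][Ad_ρ Y₃] = D³Θ(M)[Y₁][Y₂][Y₃]` for `Θ ∈ C³` invariant under `Ad ρ_u(θ)`. [cite: Helgason2000, Ch. II §4] -/
theorem flowRot_invariant_nestedFDeriv_three_eq (Θ : Matrix (Fin 3) (Fin 3) ℂ → G) (hΘ : ContDiff ℝ 3 Θ) (u : ℂ)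
    (hΘK : ∀ (θ : ℝ) (X : Matrix (Fin 3) (Fin 3) ℂ),
      Θ ((!![(Real.cos θ : ℂ), star u * (Real.sin θ : ℂ), 0; -(u * (Real.sin θ : ℂ)), (Real.cos θ : ℂ), 0; 0, 0, 1] : Matrix (Fin 3) (Fin 3) ℂ) * X *
        (!![(Real.cos θ : ℂ), star u * (Real.sin θ : ℂ), 0; -(u * (Real.sin θ : ℂ)), (Real.cos θ : ℂ), 0; 0, 0, 1] : Matrix (Fin 3) (Fin 3) ℂ)ᴴ) = Θ X)
    (θ : ℝ) (M Y₁ Y₂ Y₃ : Matrix (Fin 3) (Fin 3) ℂ) :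
    fderiv ℝ (fderiv ℝ (fderiv ℝ Θ)) ((!![(Real.cos θ : ℂ), star u * (Real.sin θ : ℂ), 0; -(u * (Real.sin θ : ℂ)), (Real.cos θ : ℂ), 0; 0, 0, 1] : Matrix (Fin 3) (Fin 3) ℂ) * M *
        (!![(Real.cos θ : ℂ), star u * (Real.sin θ : ℂ), 0; -(u * (Real.sin θ : ℂ)), (Real.cos θ : ℂ), 0; 0, 0, 1] : Matrix (Fin 3) (Fin 3) ℂ)ᴴ)
      ((!![(Real.cos θ : ℂ), star u * (Real.sin θ : ℂ), 0; -(u * (Real.sin θ : ℂ)), (Real.cos θ : ℂ), 0; 0, 0, 1] : Matrix (Fin 3) (Fin 3) ℂ) * Y₁ *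
        (!![(Real.cos θ : ℂ), star u * (Real.sin θ : ℂ), 0; -(u * (Real.sin θ : ℂ)), (Real.cos θ : ℂ), 0; 0, 0, 1] : Matrix (Fin 3) (Fin 3) ℂ)ᴴ)
      ((!![(Real.cos θ : ℂ), star u * (Real.sin θ : ℂ), 0; -(u * (Real.sin θ : ℂ)), (Real.cos θ : ℂ), 0; 0, 0, 1] : Matrix (Fin 3) (Fin 3) ℂ) * Y₂ *
        (!![(Real.cos θ : ℂ), star u * (Real.sin θ : ℂ), 0; -(u * (Real.sin θ : ℂ)), (Real.cos θ : ℂ), 0; 0, 0, 1] : Matrix (Fin 3) (Fin 3) ℂ)ᴴ)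
      ((!![(Real.cos θ : ℂ), star u * (Real.sin θ : ℂ), 0; -(u * (Real.sin θ : ℂ)), (Real.cos θ : ℂ), 0; 0, 0, 1] : Matrix (Fin 3) (Fin 3) ℂ) * Y₃ *
        (!![(Real.cos θ : ℂ), star u * (Real.sin θ : ℂ), 0; -(u * (Real.sin θ : ℂ)), (Real.cos θ : ℂ), 0; 0, 0, 1] : Matrix (Fin 3) (Fin 3) ℂ)ᴴ) =
      fderiv ℝ (fderiv ℝ (fderiv ℝ Θ)) M Y₁ Y₂ Y₃ := by
  have hcomp := comp_mulLeftRight_flowRot_eq Θ u hΘK θ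
  have h := nestedFDeriv_three_comp_clm (ContinuousLinearMap.mulLeftRight ℝ (Matrix (Fin 3) (Fin 3) ℂ) (!![(Real.cos θ : ℂ), star u * (Real.sin θ : ℂ), 0; -(u * (Real.sin θ : ℂ)), (Real.cos θ : ℂ), 0; 0, 0, 1] : Matrix (Fin 3) (Fin 3) ℂ) (!![(Real.cos θ : ℂ), star u * (Real.sin θ : ℂ), 0; -(u * (Real.sin θ : ℂ)), (Real.cos θ : ℂ), 0; 0, 0, 1] : Matrix (Fin 3) (Fin 3) ℂ)ᴴ) hΘ M Y₁ Y₂ Y₃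
  rw [hcomp] at h
  simp only [ContinuousLinearMap.mulLeftRight_apply] at h
  exact h.symm

/-- **NULL RELATION OF ORDER 3**: `D⁴Θ(M)[X̃M − MX̃, Y₁, Y₂, Y₃] + Σᵢ D³Θ(M)[…, X̃Yᵢ − YᵢX̃, …] = 0` for `Θ ∈ C⁴` invariant under `Ad ρ_u(θ)` (the fourth-order term is written
with `iteratedFDeriv ℝ 4` — the quadruply nested `fderiv` does not elaborate on the scoped-normed matrix type unaided; ★ `iteratedFDeriv_four_eq_nestedFDeriv` converts).
[cite: Helgason2000, Ch. II §4] [cite: Rogawski1990, §8.4 pp. 126–127] -/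
theorem kInvariant_null_order3 (Θ : Matrix (Fin 3) (Fin 3) ℂ → G) (hΘ : ContDiff ℝ 4 Θ) (u : ℂ)
    (hΘK : ∀ (θ : ℝ) (X : Matrix (Fin 3) (Fin 3) ℂ),
      Θ ((!![(Real.cos θ : ℂ), star u * (Real.sin θ : ℂ), 0; -(u * (Real.sin θ : ℂ)), (Real.cos θ : ℂ), 0; 0, 0, 1] : Matrix (Fin 3) (Fin 3) ℂ) * X *
        (!![(Real.cos θ : ℂ), star u * (Real.sin θ : ℂ), 0; -(u * (Real.sin θ : ℂ)), (Real.cos θ : ℂ), 0; 0, 0, 1] : Matrix (Fin 3) (Fin 3) ℂ)ᴴ) = Θ X)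
    (M Y₁ Y₂ Y₃ : Matrix (Fin 3) (Fin 3) ℂ) :
    iteratedFDeriv ℝ 4 Θ M ![((!![(0 : ℂ), star u, 0; -u, 0, 0; 0, 0, 0] : Matrix (Fin 3) (Fin 3) ℂ) * M - M * !![(0 : ℂ), star u, 0; -u, 0, 0; 0, 0, 0]), Y₁, Y₂, Y₃] +
      fderiv ℝ (fderiv ℝ (fderiv ℝ Θ)) M ((!![(0 : ℂ), star u, 0; -u, 0, 0; 0, 0, 0] : Matrix (Fin 3) (Fin 3) ℂ) * Y₁ - Y₁ * !![(0 : ℂ), star u, 0; -u, 0, 0; 0, 0, 0]) Y₂ Y₃ +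
      fderiv ℝ (fderiv ℝ (fderiv ℝ Θ)) M Y₁ ((!![(0 : ℂ), star u, 0; -u, 0, 0; 0, 0, 0] : Matrix (Fin 3) (Fin 3) ℂ) * Y₂ - Y₂ * !![(0 : ℂ), star u, 0; -u, 0, 0; 0, 0, 0]) Y₃ +
      fderiv ℝ (fderiv ℝ (fderiv ℝ Θ)) M Y₁ Y₂ ((!![(0 : ℂ), star u, 0; -u, 0, 0; 0, 0, 0] : Matrix (Fin 3) (Fin 3) ℂ) * Y₃ - Y₃ * !![(0 : ℂ), star u, 0; -u, 0, 0; 0, 0, 0]) = 0 := by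
  have hconst : (fun θ : ℝ => fderiv ℝ (fderiv ℝ (fderiv ℝ Θ))
      ((!![(Real.cos θ : ℂ), star u * (Real.sin θ : ℂ), 0; -(u * (Real.sin θ : ℂ)), (Real.cos θ : ℂ), 0; 0, 0, 1] : Matrix (Fin 3) (Fin 3) ℂ) * M *
        (!![(Real.cos θ : ℂ), star u * (Real.sin θ : ℂ), 0; -(u * (Real.sin θ : ℂ)), (Real.cos θ : ℂ), 0; 0, 0, 1] : Matrix (Fin 3) (Fin 3) ℂ)ᴴ)
      ((!![(Real.cos θ : ℂ), star u * (Real.sin θ : ℂ), 0; -(u * (Real.sin θ : ℂ)), (Real.cos θ : ℂ), 0; 0, 0, 1] : Matrix (Fin 3) (Fin 3) ℂ) * Y₁ *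
        (!![(Real.cos θ : ℂ), star u * (Real.sin θ : ℂ), 0; -(u * (Real.sin θ : ℂ)), (Real.cos θ : ℂ), 0; 0, 0, 1] : Matrix (Fin 3) (Fin 3) ℂ)ᴴ)
      ((!![(Real.cos θ : ℂ), star u * (Real.sin θ : ℂ), 0; -(u * (Real.sin θ : ℂ)), (Real.cos θ : ℂ), 0; 0, 0, 1] : Matrix (Fin 3) (Fin 3) ℂ) * Y₂ *
        (!![(Real.cos θ : ℂ), star u * (Real.sin θ : ℂ), 0; -(u * (Real.sin θ : ℂ)), (Real.cos θ : ℂ), 0; 0, 0, 1] : Matrix (Fin 3) (Fin 3) ℂ)ᴴ)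
      ((!![(Real.cos θ : ℂ), star u * (Real.sin θ : ℂ), 0; -(u * (Real.sin θ : ℂ)), (Real.cos θ : ℂ), 0; 0, 0, 1] : Matrix (Fin 3) (Fin 3) ℂ) * Y₃ *
        (!![(Real.cos θ : ℂ), star u * (Real.sin θ : ℂ), 0; -(u * (Real.sin θ : ℂ)), (Real.cos θ : ℂ), 0; 0, 0, 1] : Matrix (Fin 3) (Fin 3) ℂ)ᴴ)) =
      fun _ => fderiv ℝ (fderiv ℝ (fderiv ℝ Θ)) M Y₁ Y₂ Y₃ := by
    funext θ; exact flowRot_invariant_nestedFDeriv_three_eq Θ (hΘ.of_le (by norm_cast)) u hΘK θ M Y₁ Y₂ Y₃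
  have hd := (hasDerivAt_nestedFDeriv_three_apply_curves hΘ (hasDerivAt_flowRot_conj_zero u M) (hasDerivAt_flowRot_conj_zero u Y₁)
    (hasDerivAt_flowRot_conj_zero u Y₂) (hasDerivAt_flowRot_conj_zero u Y₃)).congr_of_eventuallyEq
    (f₁ := fun _ : ℝ => fderiv ℝ (fderiv ℝ (fderiv ℝ Θ)) M Y₁ Y₂ Y₃) (Eventually.of_forall fun θ => (congrFun hconst θ).symm)
  have h0 := (hasDerivAt_const (0 : ℝ) (fderiv ℝ (fderiv ℝ (fderiv ℝ Θ)) M Y₁ Y₂ Y₃)).unique hd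
  rw [flowRot_zero, conjTranspose_one] at h0
  simp only [Matrix.one_mul, Matrix.mul_one] at h0
  rw [iteratedFDeriv_four_eq_nestedFDeriv hΘ]
  exact h0.symm

end Nulls

end Literature.Geometry.ComplexHyperbolic.BallModel

end
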